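import Mathlib
import HarnessLib

/-!
# Markman 2025 — LEMMA 3.2.1 (v2 p. 24 L49–p. 25 L4): the joint eigenspaces of a complex structure `I` commuting with
# `f = η_{√−d}`, the eigenspaces `L₁, L₂` of `I ∘ f`, the isotropy behind (3.2.1) — the printed proof's linear
# algebra AS PRINTED, kernel-checked in operator form; with LEMMA 4.0.1's «V_I^{1,0} = U ⊕ [U^⊥ ∩ W_{2,ℂ}]» paragraph
# and COROLLARY 4.0.4's «type (1, 1) iff I(α) = α» sentence

E. Markman: [M] *Cycles on abelian 2n-folds of Weil type from secant sheaves on abelian n-folds*,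
arXiv:2502.03415 **v2**, bib `Markman2025SecantWeil` — UNREFEREED PREPRINT. «v2 p. N L m» = PyMuPDF line `m` of PDF
page `N` of the public arXiv PDF (sha256/16 `8155aa33870069b8`); read BY EYE at seat lit-w-markman g19 (pub-hsemireg
LIT-W, 2026-08-24) on the 160-dpi renders `r_mar25v2_p24_sec32_head.png` (`ff0122ffa82740be`),
`r_mar25v2_p24_lemma321.png` (`3960e6cf018e9e5b`), `r_mar25v2_p25_top_cor322.png` (`313173f532a503a0`) — and for §D–§F
`r_mar25v2_p25_sec4_lemma401.png` (`64b70806b171d14d`), `r_mar25v2_p26_lemma401_proof.png` (`3d2d6fa06525ff7e`),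
`r_mar25v2_p27_cor404.png` (`19a8525ab83314b3`) — in `HOME/lit/Markman-renders-litw-markman-g19/`; pre-filing statement reads ×2
across seats by lit-3 g55 (cell bus l.18285 on §A–§D, l.18369 on §E: CONCUR; its locator precision (P1) on p. 26 folded).

## What is printed (verbatim, by eye; three harmless misprints marked [sic])

§3.2 (v2 p. 24 L41–48): «Let `Ĩ` be an element of `Spin(V_ℝ)_P`, such that `I := ρ(Ĩ)` is a complex structure on
`V_ℝ`. `I` belongs to `ρ(Spin(V_ℝ)_P)` and so it commutes with `f := η_{√−d}`, by Lemma 3.1.1. Hence, `I ∘ f)² = d𝟙_{V_ℝ}`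
[sic: «`(I ∘ f)²`»]. Let `ν(I)` be the multiplicity of the positive square root `√d` as an eigenvalue of `I ∘ f`.»
LEMMA 3.2.1 (p. 24 L49–57): «Assume that `ν(I) = 2n`. Let `V^{1,0}` and `V^{0,1}` be the eigenspaces of `I` in `V_ℂ`
with eigenvalues `±√−1`. Then each of `V^{1,0}` and `V^{0,1}` intersects each of `W_{1,ℂ}` and `W_{2,ℂ}` along an
`n`-dimensional subspace. Furthermore, we have (3.2.1) `V^{1,0} ∩ W_{2,ℂ} = (V^{1,0} ∩ W_{1,ℂ})^⊥ ∩ W_{2,ℂ}`, where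
`(V^{1,0} ∩ W_{1,ℂ})^⊥` is the subspace orthogonal to `V^{1,0} ∩ W_{1,ℂ}` with respect to the pairing `(•, •)_V`.»
PROOF (p. 24 L58–p. 25 L4): «The elements `I` and `f` are simultaneously diagonalizable and
`(V^{1,0} ∩ W_{1,ℂ}) ⊕ (V^{1,0} ∩ W_{2,ℂ}) ⊕ (V^{0,1} ∩ W_{1,ℂ}) ⊕ (V^{0,1} ∩ W_{2,ℂ}) = V_ℂ`. The dimension of each
direct summand above in `n` [sic], by Remark 2.2.5 and Lemma 2.2.6 in the special case when `I` is associated to a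
complex structure on `X` and `P` is contain [sic] in the Hodge ring. We provide a proof below for the general case.
The subspace `V^{1,0} ∩ W_{1,ℂ}` is the simultaneous eigenspace with eigenvalues `√−1` for `I` and `√−d` for `f`, and
we will abbreviate it by saying that it is the `(√−1, √−d)`-eigenspace. Similarly, the other three summands are the
`(√−1, −√−d)`, `(−√−1, √−d)`, and `(−√−1, −√−d)`-eigenspaces. Now `(I∘f)² = d𝟙_{V_ℝ}` and `I∘f` is defined over `ℝ`.
Hence, its eigenspaces `L₁` and `L₂` in `V_ℂ`, with eigenvalues `−√d` and `√d` respectively, are defined over `ℝ`.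
Clearly, `L₁ = (V^{1,0}∩W_{1,ℂ})+(V^{0,1}∩W_{2,ℂ})` and `L₂ = (V^{1,0}∩W_{2,ℂ})+(V^{0,1}∩W_{1,ℂ})`. So
`L₁ ∩ W_{1,ℂ} = V^{1,0} ∩ W_{1,ℂ}` and `L₂ ∩ W_{1,ℂ} = V^{0,1} ∩ W_{1,ℂ}` and similarly for `W_{2,ℂ}`. Finally,
`σ(L₁ ∩ W_{1,ℂ}) = L₁ ∩ W_{2,ℂ}` and `σ(L₂ ∩ W_{1,ℂ}) = L₂ ∩ W_{2,ℂ}`. The equality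
`dim(L₁ ∩ W_{1,ℂ}) + dim(L₁ ∩ W_{2,ℂ}) = dim(L₁) = 2n` implies that `dim(L₁ ∩ W_{1,ℂ}) = dim(L₁ ∩ W_{2,ℂ}) = n` and
similarly for `L₂`. The equality `(V^{1,0} ∩ W_{1,ℂ})^⊥ = (V^{1,0} ∩ W_{1,ℂ}) ⊕ (V^{1,0} ∩ W_{2,ℂ}) ⊕ (V^{0,1} ∩ W_{1,ℂ})`.
[sic] holds, since both subspaces in the above equation are `3n`-dimensional and the inclusion of the left hand side
in the right hand side follows from the fact that `V^{1,0}` and `W_{1,ℂ}` are both isotropic. Equation (3.2.1) follows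
from the equality `W_{2,ℂ} = (V^{1,0}∩W_{2,ℂ})+(V^{0,1}∩W_{2,ℂ})` and the one displayed above. □»
PRINT-READING PRECISION P-3.2.1 (recorded, nothing moves): isotropy of `V^{1,0}` and `W_{1,ℂ}` yields the inclusion of
the RIGHT hand side `(V^{1,0}∩W_{1,ℂ}) ⊕ (V^{1,0}∩W_{2,ℂ}) ⊕ (V^{0,1}∩W_{1,ℂ})` in the LEFT hand side
`(V^{1,0}∩W_{1,ℂ})^⊥` (each summand pairs to zero with `V^{1,0}∩W_{1,ℂ}`), and the dimension count `3n = 3n` then gives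
equality — this is what the kernel checks below (`triple_le_orthogonal`, `orthogonal_eq_triple`); the printed words
«left … in the right» are read accordingly.

## What this file proves (kernel-checked; theorems only — no def, no named fact, no sorry)

MODEL (operator form, as in `WeilPolarizationCompatibility.lean` / `WeilHermitianFormSignature.lean`). `F` a field
(standing for `ℂ`), `V` an `F`-space, `B : V →ₗ V →ₗ F` (Mathlib's `LinearMap.BilinForm F V`) the pairing `(•, •)_V`, endomorphisms `I`, `f`, and scalars
`i`, `s`, `d` with `i·i = −1` («`√−1`»), `s·s = −d` («`√−d`»); the printed properties enter as hypotheses where used: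
`hc` («`I` … commutes with `f`»), `hI2` (`I² = −𝟙`), `hf2` (`f² = −d𝟙`), `hI`/`hf` anti-self-duality (p. 19 L25–27,
L61–62), `2 ≠ 0`, `s ≠ 0`. Spaces: `V^{1,0} = eigenspace I i`, `V^{0,1} = eigenspace I (−i)`, `W₁ = eigenspace f s`,
`W₂ = eigenspace f (−s)` (W₁, W₂ are the `±√−d`-eigenspaces of `f = η_{√−d}`, (2.2.4)/(2.4.1)), the four joint
eigenspaces are the infima, `L₁ = eigenspace (I ∘ f) (i·s)` («eigenvalue `−√d`», as `√−1·√−d = −√d`),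
`L₂ = eigenspace (I ∘ f) (−(i·s))`, and `(·)^⊥ = B.orthogonal (·)` (Mathlib's `LinearMap.BilinForm.orthogonal`).
THEOREMS. §A «simultaneously diagonalizable»: `proj_mem_eigenspace_I_pos/neg`, `proj_mem_eigenspace_f_pos/neg`
(the explicit eigen-components `x ∓ i·I x`, `s·x ± f x`), `f_mapsTo_eigenspace_I` / `I_mapsTo_eigenspace_f` (commuting
⇒ each preserves the other's eigenspaces), `exists_joint_decomposition` (every `x` is a sum of four joint eigenvectors
— the displayed «`⊕ … = V_ℂ`», existence half), `eq_zero_of_mem_eigenspace_pair`, `eq_zero_of_add_eq_zero`,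
`negneg_eq_zero_of_mem_triple` (eigenspaces for different eigenvalues are independent — the directness half, in the
pairwise forms used below), `W2_decomposition` («`W_{2,ℂ} = (V^{1,0}∩W_{2,ℂ})+(V^{0,1}∩W_{2,ℂ})`», p. 25 L3–4).
§B: `If_sq` («`(I∘f)² = d𝟙`»), `joint_le_L1`, `joint_le_L1'`, `joint_le_L2`,
`joint_le_L2'` (the four inclusions) and `L1_eq`, `L2_eq` («Clearly, `L₁ = (V^{1,0}∩W₁)+(V^{0,1}∩W₂)` and `L₂ = …»,
the equalities), `L1_inf_W1`, `L2_inf_W1`, `L1_inf_W2`,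
`L2_inf_W2` («So `L₁ ∩ W_{1,ℂ} = V^{1,0} ∩ W_{1,ℂ}` … and similarly for `W_{2,ℂ}`»); the COUNT «`dim(L₁∩W₁) +
dim(L₁∩W₂) = dim(L₁) = 2n` implies … `= n`» is carried out in §E (`lemma321_finrank`). §C: `isOrtho_of_mem_eigenspace`
(an anti-self-dual operator's `μ`-eigenspace is isotropic when `2μ ≠ 0` — «`V^{1,0}` and `W_{1,ℂ}` are both
isotropic»), `triple_le_orthogonal` (the display's inclusion from isotropy, P-3.2.1), `orthogonal_eq_triple` (the
display itself from that inclusion and the two `3n` counts, for `B` non-degenerate), `eq321_ge` ((3.2.1) «⊇» from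
isotropy alone), `eq321` ((3.2.1) from «the equality `W_{2,ℂ} = (V^{1,0}∩W_{2,ℂ})+(V^{0,1}∩W_{2,ℂ})` and the one
displayed above» — the display taken as the hypothesis `hperp`, exactly as the printed sentence uses it) and
`eq321_of_nondegenerate` ((3.2.1) for `(•, •)_V` non-degenerate with NO count and no hypothesis on `ν(I)` — the
kernel's dimension-free road, labelled as such, not Markman's sentence). §D (LEMMA 4.0.1's proof, first paragraph,
p. 25 L48–p. 26 L13 (PyMuPDF lines; p. 26 L1–2 are the running head), renders `r_mar25v2_p25_sec4_lemma401.png` `64b70806b171d14d`, `r_mar25v2_p26_lemma401_proof.png`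
`3d2d6fa06525ff7e`): `V10_decomposition`, `V10_eq_U_sup` («`V_I^{1,0} = U ⊕ [U^⊥ ∩ W_{2,ℂ}]`, by Equation (3.2.1)» — so
`ι(I) = V_I^{1,0} ∩ W_{1,ℂ}` determines `V_I^{1,0}`), and for an arbitrary `U ⊂ W₁`: `f_mapsTo_VU`, `VU_isotropic`,
`orthogonal_U_eq`, `finrank_VU` («`V_U^{1,0} := U ⊕ [U^⊥ ∩ W_{2,ℂ}]` … is an isotropic `2n`-dimensional subspace of `V_ℂ`,
invariant under `f`», the count from `dim V = 4n`, `dim W₁ = 2n`, `dim U = n`, `(•, •)_V` non-degenerate).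
§E (THE DIMENSION STATEMENT of LEMMA 3.2.1, p. 24 L49–51 with L76–86): the real structure is MODELLED as a
conjugate-additive bijection `σ : V ≃+ V` (`σ(c·x) = c̄·σ(x)` for an involution `star` of `F`) commuting with `I` and
`f` («defined over `ℝ`»), with `ī = −i`, `s̄ = −s`; then `conj_mem_eigenspace` («`σ(L₁ ∩ W_{1,ℂ}) = L₁ ∩ W_{2,ℂ}`» at the
level of eigenvalues), `finrank_joint_le_conj` / `finrank_joint_eq_conj` (conjugate joint eigenspaces have equal
dimension — via Mathlib's `rank_le_of_injective_injectiveₛ` for the conjugate-additive restriction of `σ`), and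
`lemma321_finrank`: with `dim V = 4n` and «`ν(I) = 2n`» read as `dim L₂ = 2n`, ALL FOUR joint eigenspaces are
`n`-dimensional («each of `V^{1,0}` and `V^{0,1}` intersects each of `W_{1,ℂ}` and `W_{2,ℂ}` along an `n`-dimensional
subspace»), by the printed route `L₁ ⊕ L₂ = V`, `L₁ = E(i,s) ⊕ E(−i,−s)`, `σ`-symmetry, `n + n = 2n`.
§F (COROLLARY 4.0.4's proof, FIRST SENTENCE, p. 27 L26–27, render `r_mar25v2_p27_cor404.png` `19a8525ab83314b3`: «A class
`α` in `∧²(V_ℚ)` is of type (1, 1) with respect to a complex structure `I`, if and only if `I(α) = α`»; a 2-class modelled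
as a bilinear form `α` via the pairing, «`I(α) = α`» as `α(I x, I y) = α(x, y)`, «type (1, 1)» as «vanishes on
`V^{1,0} × V^{1,0}` and `V^{0,1} × V^{0,1}`»): `typeOneOne_of_invariant`, `invariant_of_typeOneOne` (the two directions;
COROLLARY 4.0.4 itself and the rest of its proof BY VALUE).
BY VALUE / NOT formalised: `Spin(V_ℝ)_P`, `ρ`, Lemma 3.1.1 (that `I` commutes with `f`), that `V_ℂ = V_ℝ ⊗ ℂ` with its
complex conjugation IS such a `σ` (the model's only input), Remark 2.2.5 / Lemma 2.2.6, COROLLARY 3.2.2 (Hodge types),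
Lemma 2.2.7, Lemma 4.0.3 (1), COROLLARY 4.0.4.  Honest framing (pub-hsemireg): printed linear algebra re-checked; nothing here bears
on the Hodge conjecture or re-proves a theorem of [M]. Bookkeeping for TABLE row M-Mk1 / `WeilPeriodDomainDimension.lean`
(which takes «`ν(I) = 2n`» and the `n`-dimensionality by value).
-/

namespace Literature.AlgebraicGeometry.Markman2025

namespace JointEigenspaces321

open Module Module.End LinearMap

variable {F : Type*} [Field F] {V : Type*} [AddCommGroup V] [Module F V]
variable (B : LinearMap.BilinForm F V) (f I : Module.End F V) (i s d : F)

/-! ### §A «The elements `I` and `f` are simultaneously diagonalizable» -/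

/-- `x − i·I(x)` lies in the `√−1`-eigenspace `V^{1,0}` of `I` (`I² = −𝟙`, `i² = −1`).
[cite: Markman2025SecantWeil, Lemma 3.2.1 (proof), v2 p. 24 L58–59] -/
theorem proj_mem_eigenspace_I_pos (hI2 : ∀ x, I (I x) = -x) (hi : i * i = -1) (x : V) :
    x - i • I x ∈ eigenspace I i := by
  rw [mem_eigenspace_iff, map_sub, map_smul, hI2, smul_sub, smul_smul, hi]
  module

/-- `x + i·I(x)` lies in the `−√−1`-eigenspace `V^{0,1}` of `I`.
[cite: Markman2025SecantWeil, Lemma 3.2.1 (proof), v2 p. 24 L58–59] -/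
theorem proj_mem_eigenspace_I_neg (hI2 : ∀ x, I (I x) = -x) (hi : i * i = -1) (x : V) :
    x + i • I x ∈ eigenspace I (-i) := by
  rw [mem_eigenspace_iff, map_add, map_smul, hI2, neg_smul, smul_add, smul_smul, hi]
  module

/-- `s·x + f(x)` lies in the `√−d`-eigenspace `W₁` of `f` (`f² = −d𝟙`, `s² = −d`).
[cite: Markman2025SecantWeil, Lemma 3.2.1 (proof), v2 p. 24 L58–59; §2.2 (2.2.4), p. 14 L29–34] -/
theorem proj_mem_eigenspace_f_pos (hf2 : ∀ x, f (f x) = -(d • x)) (hs : s * s = -d) (x : V) :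
    s • x + f x ∈ eigenspace f s := by
  rw [mem_eigenspace_iff, map_add, map_smul, hf2, smul_add, smul_smul, hs]
  module

/-- `s·x − f(x)` lies in the `−√−d`-eigenspace `W₂` of `f`.
[cite: Markman2025SecantWeil, Lemma 3.2.1 (proof), v2 p. 24 L58–59; §2.2 (2.2.4), p. 14 L29–34] -/
theorem proj_mem_eigenspace_f_neg (hf2 : ∀ x, f (f x) = -(d • x)) (hs : s * s = -d) (x : V) :
    s • x - f x ∈ eigenspace f (-s) := by
  rw [mem_eigenspace_iff, map_sub, map_smul, hf2, neg_smul, smul_sub, smul_smul, hs]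
  module

/-- «`I` … commutes with `f`» ⇒ `f` maps each eigenspace of `I` into itself (so the `f`-components of an
`I`-eigenvector stay in the same `I`-eigenspace). [cite: Markman2025SecantWeil, §3.2, v2 p. 24 L42–44; Lemma 3.2.1 (proof), p. 24 L58] -/
theorem f_mapsTo_eigenspace_I (hc : ∀ x, f (I x) = I (f x)) (μ : F) {x : V} (hx : x ∈ eigenspace I μ) :
    f x ∈ eigenspace I μ := by
  rw [mem_eigenspace_iff] at hx ⊢
  rw [← hc, hx, map_smul]

/-- … and `I` maps each eigenspace of `f` (`W₁`, `W₂`) into itself.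
[cite: Markman2025SecantWeil, §3.2, v2 p. 24 L42–44; Lemma 3.2.1 (proof), p. 24 L58] -/
theorem I_mapsTo_eigenspace_f (hc : ∀ x, f (I x) = I (f x)) (μ : F) {x : V} (hx : x ∈ eigenspace f μ) :
    I x ∈ eigenspace f μ := by
  rw [mem_eigenspace_iff] at hx ⊢
  rw [hc, hx, map_smul]

/-- Eigenspaces of one operator for different eigenvalues meet in `0`.
[cite: Markman2025SecantWeil, Lemma 3.2.1 (proof), v2 p. 24 L58–59] -/
theorem eq_zero_of_mem_eigenspace_pair (g : Module.End F V) {μ ν : F} (hμν : μ ≠ ν) {x : V}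
    (hμ : x ∈ eigenspace g μ) (hν : x ∈ eigenspace g ν) : x = 0 := by
  rw [mem_eigenspace_iff] at hμ hν
  have h : (μ - ν) • x = 0 := by rw [sub_smul, ← hμ, ← hν, sub_self]
  rcases smul_eq_zero.mp h with h' | h'
  · exact absurd (sub_eq_zero.mp h') hμν
  · exact h'

/-- «`(V^{1,0} ∩ W_{1,ℂ}) ⊕ (V^{1,0} ∩ W_{2,ℂ}) ⊕ (V^{0,1} ∩ W_{1,ℂ}) ⊕ (V^{0,1} ∩ W_{2,ℂ}) = V_ℂ`», existence half:
every `x` is a sum of four joint eigenvectors (for `2 ≠ 0`, `s ≠ 0`; explicitly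
`4s·x = [s·y + f y] + [s·y − f y] + [s·z + f z] + [s·z − f z]` with `y = x − i·I x`, `z = x + i·I x`).
[cite: Markman2025SecantWeil, Lemma 3.2.1 (proof), v2 p. 24 L58–59] -/
theorem exists_joint_decomposition (hc : ∀ x, f (I x) = I (f x)) (hI2 : ∀ x, I (I x) = -x)
    (hf2 : ∀ x, f (f x) = -(d • x)) (hi : i * i = -1) (hs : s * s = -d) (h2 : (2 : F) ≠ 0) (hs0 : s ≠ 0)
    (x : V) :
    ∃ a b c e : V, a ∈ eigenspace I i ⊓ eigenspace f s ∧ b ∈ eigenspace I i ⊓ eigenspace f (-s) ∧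
      c ∈ eigenspace I (-i) ⊓ eigenspace f s ∧ e ∈ eigenspace I (-i) ⊓ eigenspace f (-s) ∧
      x = a + b + c + e := by
  set y := x - i • I x with hy
  set z := x + i • I x with hz
  have hyI : y ∈ eigenspace I i := proj_mem_eigenspace_I_pos I i hI2 hi x
  have hzI : z ∈ eigenspace I (-i) := proj_mem_eigenspace_I_neg I i hI2 hi x
  set t : F := (4 * s)⁻¹ with ht
  have h4s : (4 : F) * s ≠ 0 := mul_ne_zero (by
    have : (4 : F) = 2 * 2 := by norm_num
    rw [this]; exact mul_ne_zero h2 h2) hs0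
  refine ⟨t • (s • y + f y), t • (s • y - f y), t • (s • z + f z), t • (s • z - f z), ?_, ?_, ?_, ?_, ?_⟩
  · exact ⟨Submodule.smul_mem _ _ (Submodule.add_mem _ (Submodule.smul_mem _ _ hyI)
      (f_mapsTo_eigenspace_I f I hc i hyI)), Submodule.smul_mem _ _ (proj_mem_eigenspace_f_pos f s d hf2 hs y)⟩
  · exact ⟨Submodule.smul_mem _ _ (Submodule.sub_mem _ (Submodule.smul_mem _ _ hyI)
      (f_mapsTo_eigenspace_I f I hc i hyI)), Submodule.smul_mem _ _ (proj_mem_eigenspace_f_neg f s d hf2 hs y)⟩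
  · exact ⟨Submodule.smul_mem _ _ (Submodule.add_mem _ (Submodule.smul_mem _ _ hzI)
      (f_mapsTo_eigenspace_I f I hc (-i) hzI)), Submodule.smul_mem _ _ (proj_mem_eigenspace_f_pos f s d hf2 hs z)⟩
  · exact ⟨Submodule.smul_mem _ _ (Submodule.sub_mem _ (Submodule.smul_mem _ _ hzI)
      (f_mapsTo_eigenspace_I f I hc (-i) hzI)), Submodule.smul_mem _ _ (proj_mem_eigenspace_f_neg f s d hf2 hs z)⟩
  · have hsum : t • (s • y + f y) + t • (s • y - f y) + t • (s • z + f z) + t • (s • z - f z) =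
        (t * (4 * s)) • x := by
      rw [hy, hz]; module
    rw [hsum, ht, inv_mul_cancel₀ h4s, one_smul]

/-- «the equality `W_{2,ℂ} = (V^{1,0} ∩ W_{2,ℂ}) + (V^{0,1} ∩ W_{2,ℂ})`» (used for (3.2.1)): every `y ∈ W₂` is
`½(y − i·I y) + ½(y + i·I y)` with both halves in `W₂` (as `I` preserves `W₂`). [cite: Markman2025SecantWeil, Lemma 3.2.1 (proof), v2 p. 25 L3–4] -/
theorem W2_decomposition (hc : ∀ x, f (I x) = I (f x)) (hI2 : ∀ x, I (I x) = -x) (hi : i * i = -1)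
    (h2 : (2 : F) ≠ 0) {y : V} (hy : y ∈ eigenspace f (-s)) :
    ∃ b e : V, b ∈ eigenspace I i ⊓ eigenspace f (-s) ∧ e ∈ eigenspace I (-i) ⊓ eigenspace f (-s) ∧ y = b + e := by
  refine ⟨(2 : F)⁻¹ • (y - i • I y), (2 : F)⁻¹ • (y + i • I y), ?_, ?_, ?_⟩
  · exact ⟨Submodule.smul_mem _ _ (proj_mem_eigenspace_I_pos I i hI2 hi y), Submodule.smul_mem _ _
      (Submodule.sub_mem _ hy (Submodule.smul_mem _ _ (I_mapsTo_eigenspace_f f I hc (-s) hy)))⟩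
  · exact ⟨Submodule.smul_mem _ _ (proj_mem_eigenspace_I_neg I i hI2 hi y), Submodule.smul_mem _ _
      (Submodule.add_mem _ hy (Submodule.smul_mem _ _ (I_mapsTo_eigenspace_f f I hc (-s) hy)))⟩
  · have : (2 : F)⁻¹ • (y - i • I y) + (2 : F)⁻¹ • (y + i • I y) = ((2 : F)⁻¹ * 2) • y := by module
    rw [this, inv_mul_cancel₀ h2, one_smul]

/-- Directness in the form used for (3.2.1): a vector of the `(−√−1, −√−d)`-eigenspace lying in the sum of the other
three joint eigenspaces vanishes (for `i ≠ −i`, `s ≠ −s`). [cite: Markman2025SecantWeil, Lemma 3.2.1 (proof), v2 p. 24 L58–59] -/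
theorem negneg_eq_zero_of_mem_triple (hii : i ≠ -i) (hss : s ≠ -s) {e : V}
    (he : e ∈ eigenspace I (-i) ⊓ eigenspace f (-s))
    (he3 : e ∈ (eigenspace I i ⊓ eigenspace f s) ⊔ (eigenspace I i ⊓ eigenspace f (-s)) ⊔
      (eigenspace I (-i) ⊓ eigenspace f s)) : e = 0 := by
  obtain ⟨u, hu, c, hc, huc⟩ := Submodule.mem_sup.mp he3
  have huI : u ∈ eigenspace I i := by
    obtain ⟨a, ha, b, hb, rfl⟩ := Submodule.mem_sup.mp hu
    exact Submodule.add_mem _ ha.1 hb.1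
  have huI' : u ∈ eigenspace I (-i) := by
    have : u = e - c := by rw [← huc, add_sub_cancel_right]
    rw [this]; exact Submodule.sub_mem _ he.1 hc.1
  have hu0 : u = 0 := eq_zero_of_mem_eigenspace_pair I hii huI huI'
  rw [hu0, zero_add] at huc
  subst huc
  exact eq_zero_of_mem_eigenspace_pair f hss hc.2 he.2

/-- Directness, pairwise form: eigenvectors of one operator `g` for two different eigenvalues are independent —
if `a ∈ E_μ(g)`, `b ∈ E_ν(g)`, `μ ≠ ν` and `a + b = 0` then `a = 0` and `b = 0` (applied to `I` with `±√−1` and to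
`f` with `±√−d`, this is the «`⊕`» of the display). [cite: Markman2025SecantWeil, Lemma 3.2.1 (proof), v2 p. 24 L58–59] -/
theorem eq_zero_of_add_eq_zero (g : Module.End F V) {μ ν : F} (hμν : μ ≠ ν) {a b : V}
    (ha : a ∈ eigenspace g μ) (hb : b ∈ eigenspace g ν) (hab : a + b = 0) : a = 0 ∧ b = 0 := by
  rw [mem_eigenspace_iff] at ha hb
  have h1 : g (a + b) = 0 := by rw [hab, map_zero]
  rw [map_add, ha, hb] at h1
  have hb' : b = -a := eq_neg_of_add_eq_zero_right hab
  rw [hb', smul_neg, ← sub_eq_add_neg, ← sub_smul] at h1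
  have ha0 : a = 0 := by
    rcases smul_eq_zero.mp h1 with h | h
    · exact absurd (sub_eq_zero.mp h) hμν
    · exact h
  exact ⟨ha0, by rw [hb', ha0, neg_zero]⟩

/-! ### §B «Now `(I∘f)² = d𝟙` … its eigenspaces `L₁` and `L₂`» -/

/-- «Hence, `(I ∘ f)² = d𝟙_{V_ℝ}`» (from `I f = f I`, `I² = −𝟙`, `f² = −d𝟙`).
[cite: Markman2025SecantWeil, §3.2, v2 p. 24 L44–45] -/
theorem If_sq (hc : ∀ x, f (I x) = I (f x)) (hI2 : ∀ x, I (I x) = -x) (hf2 : ∀ x, f (f x) = -(d • x)) (x : V) :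
    (I * f) ((I * f) x) = d • x := by
  simp only [Module.End.mul_apply]
  rw [hc, hI2, hf2, neg_neg]

/-- `V^{1,0} ∩ W₁ ⊂ L₁`: on the `(√−1, √−d)`-eigenspace `I∘f` acts by `√−1·√−d` («`= −√d`»).
[cite: Markman2025SecantWeil, Lemma 3.2.1 (proof), v2 p. 24 L82] -/
theorem joint_le_L1 : eigenspace I i ⊓ eigenspace f s ≤ eigenspace (I * f) (i * s) := by
  intro x hx
  rw [Submodule.mem_inf, mem_eigenspace_iff, mem_eigenspace_iff] at hx
  obtain ⟨hxI, hxf⟩ := hx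
  rw [mem_eigenspace_iff, Module.End.mul_apply, hxf, map_smul, hxI, smul_smul]
  congr 1; ring

/-- `V^{0,1} ∩ W₂ ⊂ L₁`: on the `(−√−1, −√−d)`-eigenspace `I∘f` acts by `(−√−1)(−√−d) = √−1·√−d`.
[cite: Markman2025SecantWeil, Lemma 3.2.1 (proof), v2 p. 24 L82] -/
theorem joint_le_L1' : eigenspace I (-i) ⊓ eigenspace f (-s) ≤ eigenspace (I * f) (i * s) := by
  intro x hx
  rw [Submodule.mem_inf, mem_eigenspace_iff, mem_eigenspace_iff] at hx
  obtain ⟨hxI, hxf⟩ := hx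
  rw [mem_eigenspace_iff, Module.End.mul_apply, hxf, map_smul, hxI, smul_smul]
  congr 1; ring

/-- `V^{1,0} ∩ W₂ ⊂ L₂`: on the `(√−1, −√−d)`-eigenspace `I∘f` acts by `−(√−1·√−d)` («`= √d`»).
[cite: Markman2025SecantWeil, Lemma 3.2.1 (proof), v2 p. 24 L82] -/
theorem joint_le_L2 : eigenspace I i ⊓ eigenspace f (-s) ≤ eigenspace (I * f) (-(i * s)) := by
  intro x hx
  rw [Submodule.mem_inf, mem_eigenspace_iff, mem_eigenspace_iff] at hx
  obtain ⟨hxI, hxf⟩ := hx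
  rw [mem_eigenspace_iff, Module.End.mul_apply, hxf, map_smul, hxI, smul_smul]
  congr 1; ring

/-- `V^{0,1} ∩ W₁ ⊂ L₂`: on the `(−√−1, √−d)`-eigenspace `I∘f` acts by `−(√−1·√−d)`.
[cite: Markman2025SecantWeil, Lemma 3.2.1 (proof), v2 p. 24 L82] -/
theorem joint_le_L2' : eigenspace I (-i) ⊓ eigenspace f s ≤ eigenspace (I * f) (-(i * s)) := by
  intro x hx
  rw [Submodule.mem_inf, mem_eigenspace_iff, mem_eigenspace_iff] at hx
  obtain ⟨hxI, hxf⟩ := hx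
  rw [mem_eigenspace_iff, Module.End.mul_apply, hxf, map_smul, hxI, smul_smul]
  congr 1; ring

/-- «Clearly, `L₁ = (V^{1,0}∩W_{1,ℂ})+(V^{0,1}∩W_{2,ℂ})`» — the EQUALITY (the inclusion «⊇» is `joint_le_L1`/`joint_le_L1'`;
«⊆» by decomposing `x ∈ L₁` into its four joint components and comparing `I∘f`-eigenvalues: the `(√−1, −√−d)` and
`(−√−1, √−d)` components carry eigenvalue `−is ≠ is` and must vanish). Hypotheses: those of `exists_joint_decomposition`
and `2is ≠ 0`. [cite: Markman2025SecantWeil, Lemma 3.2.1 (proof), v2 p. 24 L82] -/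
theorem L1_eq (hc : ∀ x, f (I x) = I (f x)) (hI2 : ∀ x, I (I x) = -x) (hf2 : ∀ x, f (f x) = -(d • x))
    (hi : i * i = -1) (hs : s * s = -d) (h2 : (2 : F) ≠ 0) (hs0 : s ≠ 0) (hi0 : i ≠ 0) :
    eigenspace (I * f) (i * s) = (eigenspace I i ⊓ eigenspace f s) ⊔ (eigenspace I (-i) ⊓ eigenspace f (-s)) := by
  apply le_antisymm _ (sup_le (joint_le_L1 f I i s) (joint_le_L1' f I i s))
  intro x hx
  obtain ⟨a, b, c, e, ha, hb, hc', he, rfl⟩ := exists_joint_decomposition f I i s d hc hI2 hf2 hi hs h2 hs0 x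
  have hii : i ≠ -i := by
    intro h; apply hi0
    have : (2 : F) * i = 0 := by linear_combination h
    rcases mul_eq_zero.mp this with h' | h'
    · exact absurd h' h2
    · exact h'
  -- eigenvalues of `I∘f` on the four components
  have ea := mem_eigenspace_iff.mp (joint_le_L1 f I i s ha)
  have eb := mem_eigenspace_iff.mp (joint_le_L2 f I i s hb)
  have ec := mem_eigenspace_iff.mp (joint_le_L2' f I i s hc')
  have ee := mem_eigenspace_iff.mp (joint_le_L1' f I i s he)
  have hx' := mem_eigenspace_iff.mp hx
  rw [map_add, map_add, map_add, ea, eb, ec, ee] at hx'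
  -- compare: (is)(a+b+c+e) = is a − is b − is c + is e  ⇒  (2is)•(b + c) = 0
  have hbc : (2 * (i * s)) • (b + c) = 0 := by
    have h' : (i * s) • a + -(i * s) • b + -(i * s) • c + (i * s) • e - (i * s) • (a + b + c + e) = 0 := by
      rw [hx', sub_self]
    have : (2 * (i * s)) • (b + c) = -((i * s) • a + -(i * s) • b + -(i * s) • c + (i * s) • e - (i * s) • (a + b + c + e)) := by
      module
    rw [this, h', neg_zero]
  have h2is : (2 : F) * (i * s) ≠ 0 := mul_ne_zero h2 (mul_ne_zero hi0 hs0)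
  have hbc0 : b + c = 0 := by
    rcases smul_eq_zero.mp hbc with h' | h'
    · exact absurd h' h2is
    · exact h'
  obtain ⟨hb0, hc0⟩ := eq_zero_of_add_eq_zero I hii hb.1 hc'.1 hbc0
  rw [hb0, hc0, add_zero, add_zero]
  exact Submodule.add_mem_sup ha he

/-- «… and `L₂ = (V^{1,0}∩W_{2,ℂ})+(V^{0,1}∩W_{1,ℂ})`» — the EQUALITY, likewise.
[cite: Markman2025SecantWeil, Lemma 3.2.1 (proof), v2 p. 24 L82] -/
theorem L2_eq (hc : ∀ x, f (I x) = I (f x)) (hI2 : ∀ x, I (I x) = -x) (hf2 : ∀ x, f (f x) = -(d • x))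
    (hi : i * i = -1) (hs : s * s = -d) (h2 : (2 : F) ≠ 0) (hs0 : s ≠ 0) (hi0 : i ≠ 0) :
    eigenspace (I * f) (-(i * s)) = (eigenspace I i ⊓ eigenspace f (-s)) ⊔ (eigenspace I (-i) ⊓ eigenspace f s) := by
  apply le_antisymm _ (sup_le (joint_le_L2 f I i s) (joint_le_L2' f I i s))
  intro x hx
  obtain ⟨a, b, c, e, ha, hb, hc', he, rfl⟩ := exists_joint_decomposition f I i s d hc hI2 hf2 hi hs h2 hs0 x
  have hii : i ≠ -i := by
    intro h; apply hi0
    have : (2 : F) * i = 0 := by linear_combination h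
    rcases mul_eq_zero.mp this with h' | h'
    · exact absurd h' h2
    · exact h'
  have ea := mem_eigenspace_iff.mp (joint_le_L1 f I i s ha)
  have eb := mem_eigenspace_iff.mp (joint_le_L2 f I i s hb)
  have ec := mem_eigenspace_iff.mp (joint_le_L2' f I i s hc')
  have ee := mem_eigenspace_iff.mp (joint_le_L1' f I i s he)
  have hx' := mem_eigenspace_iff.mp hx
  rw [map_add, map_add, map_add, ea, eb, ec, ee] at hx'
  have hae : (2 * (i * s)) • (a + e) = 0 := by
    have h' : (i * s) • a + -(i * s) • b + -(i * s) • c + (i * s) • e - (-(i * s)) • (a + b + c + e) = 0 := by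
      rw [hx', sub_self]
    have : (2 * (i * s)) • (a + e) = (i * s) • a + -(i * s) • b + -(i * s) • c + (i * s) • e - (-(i * s)) • (a + b + c + e) := by
      module
    rw [this, h']
  have h2is : (2 : F) * (i * s) ≠ 0 := mul_ne_zero h2 (mul_ne_zero hi0 hs0)
  have hae0 : a + e = 0 := by
    rcases smul_eq_zero.mp hae with h' | h'
    · exact absurd h' h2is
    · exact h'
  obtain ⟨ha0, he0⟩ := eq_zero_of_add_eq_zero I hii ha.1 he.1 hae0
  rw [ha0, he0, zero_add, add_zero]
  exact Submodule.add_mem_sup hb hc'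

/-- «So `L₁ ∩ W_{1,ℂ} = V^{1,0} ∩ W_{1,ℂ}`» (for `s ≠ 0`: on `W₁`, `I f x = sI x`, so `I f x = (is)x` iff `I x = i x`).
[cite: Markman2025SecantWeil, Lemma 3.2.1 (proof), v2 p. 24 L83] -/
theorem L1_inf_W1 (hs0 : s ≠ 0) :
    eigenspace (I * f) (i * s) ⊓ eigenspace f s = eigenspace I i ⊓ eigenspace f s := by
  ext x
  simp only [Submodule.mem_inf, mem_eigenspace_iff, Module.End.mul_apply]
  constructor
  · rintro ⟨h1, h2⟩
    refine ⟨?_, h2⟩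
    rw [h2, map_smul] at h1
    have h1' : s • I x = s • (i • x) := by
      rw [h1, smul_smul]; congr 1; ring
    exact smul_right_injective V hs0 h1'
  · rintro ⟨h1, h2⟩
    refine ⟨?_, h2⟩
    rw [h2, map_smul, h1, smul_smul]; congr 1; ring

/-- «… and `L₂ ∩ W_{1,ℂ} = V^{0,1} ∩ W_{1,ℂ}`». [cite: Markman2025SecantWeil, Lemma 3.2.1 (proof), v2 p. 24 L83] -/
theorem L2_inf_W1 (hs0 : s ≠ 0) :
    eigenspace (I * f) (-(i * s)) ⊓ eigenspace f s = eigenspace I (-i) ⊓ eigenspace f s := by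
  ext x
  simp only [Submodule.mem_inf, mem_eigenspace_iff, Module.End.mul_apply]
  constructor
  · rintro ⟨h1, h2⟩
    refine ⟨?_, h2⟩
    rw [h2, map_smul] at h1
    have h1' : s • I x = s • ((-i) • x) := by
      rw [h1, smul_smul]; congr 1; ring
    exact smul_right_injective V hs0 h1'
  · rintro ⟨h1, h2⟩
    refine ⟨?_, h2⟩
    rw [h2, map_smul, h1, smul_smul]; congr 1; ring

/-- «… and similarly for `W_{2,ℂ}`»: `L₁ ∩ W_{2,ℂ} = V^{0,1} ∩ W_{2,ℂ}`.
[cite: Markman2025SecantWeil, Lemma 3.2.1 (proof), v2 p. 24 L83] -/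
theorem L1_inf_W2 (hs0 : s ≠ 0) :
    eigenspace (I * f) (i * s) ⊓ eigenspace f (-s) = eigenspace I (-i) ⊓ eigenspace f (-s) := by
  ext x
  simp only [Submodule.mem_inf, mem_eigenspace_iff, Module.End.mul_apply]
  constructor
  · rintro ⟨h1, h2⟩
    refine ⟨?_, h2⟩
    rw [h2, map_smul] at h1
    have h1' : (-s) • I x = (-s) • ((-i) • x) := by
      rw [h1, smul_smul]; congr 1; ring
    exact smul_right_injective V (neg_ne_zero.mpr hs0) h1'
  · rintro ⟨h1, h2⟩
    refine ⟨?_, h2⟩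
    rw [h2, map_smul, h1, smul_smul]; congr 1; ring

/-- «… and similarly for `W_{2,ℂ}`»: `L₂ ∩ W_{2,ℂ} = V^{1,0} ∩ W_{2,ℂ}`.
[cite: Markman2025SecantWeil, Lemma 3.2.1 (proof), v2 p. 24 L83] -/
theorem L2_inf_W2 (hs0 : s ≠ 0) :
    eigenspace (I * f) (-(i * s)) ⊓ eigenspace f (-s) = eigenspace I i ⊓ eigenspace f (-s) := by
  ext x
  simp only [Submodule.mem_inf, mem_eigenspace_iff, Module.End.mul_apply]
  constructor
  · rintro ⟨h1, h2⟩
    refine ⟨?_, h2⟩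
    rw [h2, map_smul] at h1
    have h1' : (-s) • I x = (-s) • (i • x) := by
      rw [h1, smul_smul]; congr 1; ring
    exact smul_right_injective V (neg_ne_zero.mpr hs0) h1'
  · rintro ⟨h1, h2⟩
    refine ⟨?_, h2⟩
    rw [h2, map_smul, h1, smul_smul]; congr 1; ring

/-! ### §C isotropy, the displayed orthogonal complement, and (3.2.1) -/

/-- «`V^{1,0}` and `W_{1,ℂ}` are both isotropic»: for an operator `g` that is anti-self-dual for `(•, •)_V`
(`(g x, y) = −(x, g y)` — `I` by p. 19 L61–62, `f` by p. 19 L25–27), any two vectors of one eigenspace `E_μ(g)` pair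
to zero, provided `2μ ≠ 0`. [cite: Markman2025SecantWeil, Lemma 3.2.1 (proof), v2 p. 24 L91–p. 25 L3; §2.4, p. 19 L25–27, L61–62] -/
theorem isOrtho_of_mem_eigenspace (g : Module.End F V) (hg : ∀ x y, B (g x) y = -B x (g y)) {μ : F}
    (hμ : 2 * μ ≠ 0) {x y : V} (hx : x ∈ eigenspace g μ) (hy : y ∈ eigenspace g μ) : B x y = 0 := by
  rw [mem_eigenspace_iff] at hx hy
  have h := hg x y
  simp only [hx, hy, map_smul, LinearMap.smul_apply, smul_eq_mul] at h
  have h2 : (2 * μ) * B x y = 0 := by linear_combination h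
  rcases mul_eq_zero.mp h2 with h' | h'
  · exact absurd h' hμ
  · exact h'

/-- The displayed inclusion from isotropy (P-3.2.1):
`(V^{1,0}∩W₁) + (V^{1,0}∩W₂) + (V^{0,1}∩W₁) ⊂ (V^{1,0}∩W₁)^⊥` — the first two summands lie in the isotropic `V^{1,0}`,
the first and third in the isotropic `W₁`. [cite: Markman2025SecantWeil, Lemma 3.2.1 (proof), v2 p. 24 L87–p. 25 L3] -/
theorem triple_le_orthogonal (hI : ∀ x y, B (I x) y = -B x (I y)) (hf : ∀ x y, B (f x) y = -B x (f y))
    (hi2 : 2 * i ≠ 0) (hs2 : 2 * s ≠ 0) :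
    (eigenspace I i ⊓ eigenspace f s) ⊔ (eigenspace I i ⊓ eigenspace f (-s)) ⊔ (eigenspace I (-i) ⊓ eigenspace f s) ≤
      B.orthogonal (eigenspace I i ⊓ eigenspace f s) := by
  refine sup_le (sup_le ?_ ?_) ?_ <;> intro y hy <;> rw [LinearMap.BilinForm.mem_orthogonal_iff] <;> intro x hx
  · exact isOrtho_of_mem_eigenspace B I hI hi2 hx.1 hy.1
  · exact isOrtho_of_mem_eigenspace B I hI hi2 hx.1 hy.1
  · exact isOrtho_of_mem_eigenspace B f hf hs2 hx.2 hy.2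

/-- The display «`(V^{1,0} ∩ W_{1,ℂ})^⊥ = (V^{1,0} ∩ W_{1,ℂ}) ⊕ (V^{1,0} ∩ W_{2,ℂ}) ⊕ (V^{0,1} ∩ W_{1,ℂ})`» — «since both
subspaces … are `3n`-dimensional» and the inclusion from isotropy: for `(•, •)_V` non-degenerate on the
`4n`-dimensional `V`, with `dim(V^{1,0}∩W₁) = n` and the triple sum `3n`-dimensional (both by value, as printed).
[cite: Markman2025SecantWeil, Lemma 3.2.1 (proof), v2 p. 24 L87–p. 25 L3] -/
theorem orthogonal_eq_triple [FiniteDimensional F V] (hB : LinearMap.BilinForm.Nondegenerate B)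
    (hI : ∀ x y, B (I x) y = -B x (I y)) (hf : ∀ x y, B (f x) y = -B x (f y)) (hi2 : 2 * i ≠ 0) (hs2 : 2 * s ≠ 0)
    (n : ℕ) (hV : finrank F V = 4 * n) (h11 : finrank F ↥(eigenspace I i ⊓ eigenspace f s) = n)
    (h3 : finrank F ↥((eigenspace I i ⊓ eigenspace f s) ⊔ (eigenspace I i ⊓ eigenspace f (-s)) ⊔
      (eigenspace I (-i) ⊓ eigenspace f s)) = 3 * n) :
    B.orthogonal (eigenspace I i ⊓ eigenspace f s) =
      (eigenspace I i ⊓ eigenspace f s) ⊔ (eigenspace I i ⊓ eigenspace f (-s)) ⊔ (eigenspace I (-i) ⊓ eigenspace f s) := by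
  symm
  apply Submodule.eq_of_le_of_finrank_eq (triple_le_orthogonal B f I i s hI hf hi2 hs2)
  rw [h3, LinearMap.BilinForm.finrank_orthogonal hB, hV, h11]
  omega

/-- (3.2.1), the inclusion «⊇» — `(V^{1,0} ∩ W₁)^⊥ ∩ W₂ ⊃ V^{1,0} ∩ W₂` — from the isotropy of `V^{1,0}` alone.
[cite: Markman2025SecantWeil, Lemma 3.2.1 (3.2.1), v2 p. 24 L52–57] -/
theorem eq321_ge (hI : ∀ x y, B (I x) y = -B x (I y)) (hi2 : 2 * i ≠ 0) :
    eigenspace I i ⊓ eigenspace f (-s) ≤ B.orthogonal (eigenspace I i ⊓ eigenspace f s) ⊓ eigenspace f (-s) := by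
  intro y hy
  refine Submodule.mem_inf.mpr ⟨?_, hy.2⟩
  rw [LinearMap.BilinForm.mem_orthogonal_iff]
  intro x hx
  exact isOrtho_of_mem_eigenspace B I hI hi2 hx.1 hy.1

/-- (3.2.1) «`V^{1,0} ∩ W_{2,ℂ} = (V^{1,0} ∩ W_{1,ℂ})^⊥ ∩ W_{2,ℂ}`» — «follows from the equality
`W_{2,ℂ} = (V^{1,0}∩W_{2,ℂ})+(V^{0,1}∩W_{2,ℂ})` [`W2_decomposition`] and the one displayed above» [the display enters
as the hypothesis `hperp` — it is `orthogonal_eq_triple` under its counts], with the directness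
`negneg_eq_zero_of_mem_triple`. [cite: Markman2025SecantWeil, Lemma 3.2.1 (3.2.1) and proof, v2 p. 24 L52–57, p. 25 L3–4] -/
theorem eq321 (hc : ∀ x, f (I x) = I (f x)) (hI2 : ∀ x, I (I x) = -x) (hi : i * i = -1) (h2 : (2 : F) ≠ 0)
    (hI : ∀ x y, B (I x) y = -B x (I y)) (hii : i ≠ -i) (hss : s ≠ -s)
    (hperp : B.orthogonal (eigenspace I i ⊓ eigenspace f s) =
      (eigenspace I i ⊓ eigenspace f s) ⊔ (eigenspace I i ⊓ eigenspace f (-s)) ⊔ (eigenspace I (-i) ⊓ eigenspace f s)) :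
    eigenspace I i ⊓ eigenspace f (-s) = B.orthogonal (eigenspace I i ⊓ eigenspace f s) ⊓ eigenspace f (-s) := by
  have hi2 : 2 * i ≠ 0 := by
    intro h; apply hii; linear_combination h
  apply le_antisymm (eq321_ge B f I i s hI hi2)
  intro y hy
  obtain ⟨hyperp, hyW2⟩ := hy
  obtain ⟨b, e, hb, he, rfl⟩ := W2_decomposition f I i s hc hI2 hi h2 hyW2
  have hbperp : b ∈ B.orthogonal (eigenspace I i ⊓ eigenspace f s) := (eq321_ge B f I i s hI hi2 hb).1
  have heperp : e ∈ B.orthogonal (eigenspace I i ⊓ eigenspace f s) := by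
    have := Submodule.sub_mem _ hyperp hbperp
    rwa [add_sub_cancel_left] at this
  rw [hperp] at heperp
  rw [negneg_eq_zero_of_mem_triple f I i s hii hss he heperp, add_zero]
  exact hb

/-- (3.2.1) by a dimension-free road (the kernel's alternative to «both subspaces are `3n`-dimensional»; recorded as
a remark, not as Markman's argument): if `(•, •)_V` is non-degenerate, `I` and `f` commute and are anti-self-dual with
`I² = −𝟙`, `f² = −d𝟙`, then a vector `e` of the `(−√−1, −√−d)`-eigenspace orthogonal to the `(√−1, √−d)`-eigenspace is
orthogonal to all four joint eigenspaces (the other three by isotropy of `V^{0,1}` and of `W₂`), hence to `V`, hence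
`e = 0`; so (3.2.1) holds with no hypothesis on `ν(I)`. [cite: Markman2025SecantWeil, Lemma 3.2.1 (3.2.1), v2 p. 24 L52–57] -/
theorem eq321_of_nondegenerate (hB : LinearMap.BilinForm.Nondegenerate B) (hc : ∀ x, f (I x) = I (f x))
    (hI2 : ∀ x, I (I x) = -x) (hf2 : ∀ x, f (f x) = -(d • x)) (hi : i * i = -1) (hs : s * s = -d)
    (h2 : (2 : F) ≠ 0) (hs0 : s ≠ 0) (hI : ∀ x y, B (I x) y = -B x (I y)) (hf : ∀ x y, B (f x) y = -B x (f y)) :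
    eigenspace I i ⊓ eigenspace f (-s) = B.orthogonal (eigenspace I i ⊓ eigenspace f s) ⊓ eigenspace f (-s) := by
  have hi0 : i ≠ 0 := by rintro rfl; simp at hi
  have hi2 : 2 * i ≠ 0 := mul_ne_zero h2 hi0
  have hi2' : 2 * (-i) ≠ 0 := mul_ne_zero h2 (neg_ne_zero.mpr hi0)
  have hs2' : 2 * (-s) ≠ 0 := mul_ne_zero h2 (neg_ne_zero.mpr hs0)
  apply le_antisymm (eq321_ge B f I i s hI hi2)
  intro y hy
  obtain ⟨hyperp, hyW2⟩ := hy
  obtain ⟨b, e, hb, he, rfl⟩ := W2_decomposition f I i s hc hI2 hi h2 hyW2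
  have hbperp : b ∈ B.orthogonal (eigenspace I i ⊓ eigenspace f s) := (eq321_ge B f I i s hI hi2 hb).1
  have heperp : e ∈ B.orthogonal (eigenspace I i ⊓ eigenspace f s) := by
    have := Submodule.sub_mem _ hyperp hbperp
    rwa [add_sub_cancel_left] at this
  rw [LinearMap.BilinForm.mem_orthogonal_iff] at heperp
  -- `e` pairs to zero with every joint eigenvector, hence with every vector
  have hBsymm_e : ∀ x, B x e = 0 := by
    intro x
    obtain ⟨a, b', c, e', ha, hb', hc', he', rfl⟩ :=
      exists_joint_decomposition f I i s d hc hI2 hf2 hi hs h2 hs0 x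
    have h1 : B a e = 0 := heperp a ha
    have h2' : B b' e = 0 := isOrtho_of_mem_eigenspace B f hf hs2' hb'.2 he.2
    have h3 : B c e = 0 := isOrtho_of_mem_eigenspace B I hI hi2' hc'.1 he.1
    have h4 : B e' e = 0 := isOrtho_of_mem_eigenspace B I hI hi2' he'.1 he.1
    simp only [map_add, LinearMap.add_apply, h1, h2', h3, h4, add_zero]
  have he0 : e = 0 := by
    apply hB.2
    intro x
    exact hBsymm_e x
  rw [he0, add_zero]
  exact hb

/-! ### §D LEMMA 4.0.1's proof, first paragraph (v2 p. 25 L48–p. 26 L13): `V_I^{1,0} = U ⊕ [U^⊥ ∩ W_{2,ℂ}]` and the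
subspace `V_U^{1,0} := U ⊕ [U^⊥ ∩ W_{2,ℂ}]` «is an isotropic `2n`-dimensional subspace of `V_ℂ`, invariant under `f`»

Printed (by eye, renders `r_mar25v2_p25_sec4_lemma401.png` `64b70806b171d14d`, `r_mar25v2_p26_lemma401_proof.png`
`3d2d6fa06525ff7e`): «Let `ι : Ω_P → Gr(n, W_{1,ℂ})` be given by `ι(I) := V_I^{1,0} ∩ W_{1,ℂ}`. … Proof. The map `ι` is
injective. Indeed, if `U = ι(I)`, then `I` is the unique complex structure on `V_ℝ` with `V_I^{1,0} = U ⊕ [U^⊥ ∩ W_{2,ℂ}]`,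
by Equation (3.2.1), where `U^⊥` is the subspace of `V_ℂ` orthogonal to `U` with respect to the pairing `(•, •)_V`. Given
an `n`-dimensional subspace `U` of `W_{1,ℂ}`, set `V_U^{1,0} := U ⊕ [U^⊥ ∩ W_{2,ℂ}]`. Then `V_U^{1,0}` is an isotropic
`2n`-dimensional subspace of `V_ℂ`, invariant under `f`.» (The rest of the proof — complex conjugation, `I_U`, openness,
`g_I`, orientation, `ν(I) = 2n`, non-emptiness — is BY VALUE; `WeilPeriodDomainDimension.lean` carries its counts.) -/

/-- `V^{1,0} = (V^{1,0} ∩ W₁) + (V^{1,0} ∩ W₂)`: every `y ∈ V^{1,0}` is `(2s)⁻¹[(s·y + f y) + (s·y − f y)]` with both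
summands in `V^{1,0}` (as `f` preserves `V^{1,0}`). [cite: Markman2025SecantWeil, Lemma 3.2.1 (proof), v2 p. 24 L58–59; Lemma 4.0.1 (proof), p. 25 L48–p. 26 L4] -/
theorem V10_decomposition (hc : ∀ x, f (I x) = I (f x)) (hf2 : ∀ x, f (f x) = -(d • x)) (hs : s * s = -d)
    (h2 : (2 : F) ≠ 0) (hs0 : s ≠ 0) {y : V} (hy : y ∈ eigenspace I i) :
    ∃ a b : V, a ∈ eigenspace I i ⊓ eigenspace f s ∧ b ∈ eigenspace I i ⊓ eigenspace f (-s) ∧ y = a + b := by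
  have h2s : (2 : F) * s ≠ 0 := mul_ne_zero h2 hs0
  refine ⟨(2 * s)⁻¹ • (s • y + f y), (2 * s)⁻¹ • (s • y - f y), ?_, ?_, ?_⟩
  · exact ⟨Submodule.smul_mem _ _ (Submodule.add_mem _ (Submodule.smul_mem _ _ hy) (f_mapsTo_eigenspace_I f I hc i hy)),
      Submodule.smul_mem _ _ (proj_mem_eigenspace_f_pos f s d hf2 hs y)⟩
  · exact ⟨Submodule.smul_mem _ _ (Submodule.sub_mem _ (Submodule.smul_mem _ _ hy) (f_mapsTo_eigenspace_I f I hc i hy)),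
      Submodule.smul_mem _ _ (proj_mem_eigenspace_f_neg f s d hf2 hs y)⟩
  · have : (2 * s)⁻¹ • (s • y + f y) + (2 * s)⁻¹ • (s • y - f y) = ((2 * s)⁻¹ * (2 * s)) • y := by module
    rw [this, inv_mul_cancel₀ h2s, one_smul]

/-- «if `U = ι(I)`, then … `V_I^{1,0} = U ⊕ [U^⊥ ∩ W_{2,ℂ}]`, by Equation (3.2.1)» — with `U = V^{1,0} ∩ W₁` and
(3.2.1) entering as the hypothesis `h321` (= `eq321` / `eq321_of_nondegenerate`): `V^{1,0}` is determined by `U`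
(whence «the map `ι` is injective»). [cite: Markman2025SecantWeil, Lemma 4.0.1 (proof), v2 p. 25 L48–p. 26 L4] -/
theorem V10_eq_U_sup (hc : ∀ x, f (I x) = I (f x)) (hf2 : ∀ x, f (f x) = -(d • x)) (hs : s * s = -d)
    (h2 : (2 : F) ≠ 0) (hs0 : s ≠ 0)
    (h321 : eigenspace I i ⊓ eigenspace f (-s) =
      B.orthogonal (eigenspace I i ⊓ eigenspace f s) ⊓ eigenspace f (-s)) :
    eigenspace I i = (eigenspace I i ⊓ eigenspace f s) ⊔
      (B.orthogonal (eigenspace I i ⊓ eigenspace f s) ⊓ eigenspace f (-s)) := by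
  apply le_antisymm
  · intro y hy
    obtain ⟨a, b, ha, hb, rfl⟩ := V10_decomposition f I i s d hc hf2 hs h2 hs0 hy
    rw [h321] at hb
    exact Submodule.add_mem_sup ha hb
  · rw [← h321]
    exact sup_le inf_le_left inf_le_left

variable (U : Submodule F V)

/-- «Then `V_U^{1,0}` is … invariant under `f`»: for `U ⊂ W₁`, `f` maps `V_U^{1,0} = U ⊕ [U^⊥ ∩ W₂]` into itself (`f`
acts by `s` on `U` and by `−s` on `W₂`). [cite: Markman2025SecantWeil, Lemma 4.0.1 (proof), v2 p. 26 L4–13] -/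
theorem f_mapsTo_VU (hU : U ≤ eigenspace f s) {x : V} (hx : x ∈ U ⊔ (B.orthogonal U ⊓ eigenspace f (-s))) :
    f x ∈ U ⊔ (B.orthogonal U ⊓ eigenspace f (-s)) := by
  obtain ⟨u, hu, w, hw, rfl⟩ := Submodule.mem_sup.mp hx
  rw [map_add]
  refine Submodule.add_mem_sup ?_ ?_
  · have hfu : f u = s • u := mem_eigenspace_iff.mp (hU hu)
    rw [hfu]; exact Submodule.smul_mem _ _ hu
  · have hfw : f w = (-s) • w := mem_eigenspace_iff.mp hw.2
    rw [hfw]; exact Submodule.smul_mem _ _ hw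

/-- «Then `V_U^{1,0}` is an isotropic … subspace»: for `(•, •)_V` symmetric, `U ⊂ W₁`, and `W₁`, `W₂` isotropic (here
from `f` anti-self-dual, `2s ≠ 0`), any two vectors of `U ⊕ [U^⊥ ∩ W₂]` pair to zero.
[cite: Markman2025SecantWeil, Lemma 4.0.1 (proof), v2 p. 26 L4–13; §2.2, p. 14 L21–24] -/
theorem VU_isotropic (hB : ∀ x y, B x y = B y x) (hf : ∀ x y, B (f x) y = -B x (f y)) (hs2 : 2 * s ≠ 0)
    (hU : U ≤ eigenspace f s) {x y : V} (hx : x ∈ U ⊔ (B.orthogonal U ⊓ eigenspace f (-s)))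
    (hy : y ∈ U ⊔ (B.orthogonal U ⊓ eigenspace f (-s))) : B x y = 0 := by
  have hs2' : 2 * (-s) ≠ 0 := by rwa [mul_neg, neg_ne_zero]
  obtain ⟨u, hu, w, hw, rfl⟩ := Submodule.mem_sup.mp hx
  obtain ⟨u', hu', w', hw', rfl⟩ := Submodule.mem_sup.mp hy
  have h1 : B u u' = 0 := isOrtho_of_mem_eigenspace B f hf hs2 (hU hu) (hU hu')
  have h2 : B u w' = 0 := (LinearMap.BilinForm.mem_orthogonal_iff.mp hw'.1) u hu
  have h3 : B w u' = 0 := by rw [hB]; exact (LinearMap.BilinForm.mem_orthogonal_iff.mp hw.1) u' hu'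
  have h4 : B w w' = 0 := isOrtho_of_mem_eigenspace B f hf hs2' hw.2 hw'.2
  simp only [map_add, LinearMap.add_apply, h1, h2, h3, h4, add_zero]

/-- `U^⊥ = W₁ ⊕ [U^⊥ ∩ W₂]` for `U ⊂ W₁` (so `W₁ ⊂ U^⊥`, `W₁` being isotropic) and `V = W₁ + W₂` — the modular law.
[cite: Markman2025SecantWeil, Lemma 4.0.1 (proof), v2 p. 26 L4–13] -/
theorem orthogonal_U_eq (hf : ∀ x y, B (f x) y = -B x (f y)) (hs2 : 2 * s ≠ 0) (hU : U ≤ eigenspace f s)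
    (hW : eigenspace f s ⊔ eigenspace f (-s) = ⊤) :
    B.orthogonal U = eigenspace f s ⊔ (B.orthogonal U ⊓ eigenspace f (-s)) := by
  have hW1 : eigenspace f s ≤ B.orthogonal U := by
    intro w hw
    rw [LinearMap.BilinForm.mem_orthogonal_iff]
    intro u hu
    exact isOrtho_of_mem_eigenspace B f hf hs2 (hU hu) hw
  rw [inf_comm, ← sup_inf_assoc_of_le _ hW1, hW, top_inf_eq]

/-- «Then `V_U^{1,0}` is [a] `2n`-dimensional subspace of `V_ℂ`» for `dim U = n`: with `(•, •)_V` non-degenerate on the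
`4n`-dimensional `V = W₁ ⊕ W₂`, `dim W₁ = 2n`, one gets `dim U^⊥ = 3n`, `dim(U^⊥ ∩ W₂) = n` and `dim V_U^{1,0} = 2n`.
[cite: Markman2025SecantWeil, Lemma 4.0.1 (proof), v2 p. 26 L4–13; §2.2, p. 14 L21–24] -/
theorem finrank_VU [FiniteDimensional F V] (hBnd : LinearMap.BilinForm.Nondegenerate B)
    (hf : ∀ x y, B (f x) y = -B x (f y)) (hs2 : 2 * s ≠ 0) (hss : s ≠ -s) (hU : U ≤ eigenspace f s)
    (hW : eigenspace f s ⊔ eigenspace f (-s) = ⊤) (n : ℕ) (hV : finrank F V = 4 * n)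
    (hW1 : finrank F ↥(eigenspace f s) = 2 * n) (hUn : finrank F ↥U = n) :
    finrank F ↥(U ⊔ (B.orthogonal U ⊓ eigenspace f (-s))) = 2 * n := by
  have hdisj : eigenspace f s ⊓ eigenspace f (-s) = ⊥ := by
    rw [eq_bot_iff]
    intro x hx
    rw [Submodule.mem_bot]
    exact eq_zero_of_mem_eigenspace_pair f hss hx.1 hx.2
  have hperp : finrank F ↥(B.orthogonal U) = 3 * n := by
    rw [LinearMap.BilinForm.finrank_orthogonal hBnd, hV, hUn]; omega
  -- dim (U^⊥ ∩ W₂) = n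
  have hX : finrank F ↥(B.orthogonal U ⊓ eigenspace f (-s)) = n := by
    have h := Submodule.finrank_sup_add_finrank_inf_eq (eigenspace f s) (B.orthogonal U ⊓ eigenspace f (-s))
    rw [← orthogonal_U_eq B f s U hf hs2 hU hW, hperp, hW1] at h
    have h0 : eigenspace f s ⊓ (B.orthogonal U ⊓ eigenspace f (-s)) = ⊥ := by
      rw [eq_bot_iff, ← hdisj]
      exact le_inf inf_le_left (inf_le_right.trans inf_le_right)
    rw [h0, finrank_bot] at h
    omega
  have h := Submodule.finrank_sup_add_finrank_inf_eq U (B.orthogonal U ⊓ eigenspace f (-s))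
  have h0 : U ⊓ (B.orthogonal U ⊓ eigenspace f (-s)) = ⊥ := by
    rw [eq_bot_iff, ← hdisj]
    exact le_inf (inf_le_left.trans hU) (inf_le_right.trans inf_le_right)
  rw [h0, finrank_bot, hX, hUn] at h
  omega

/-! ### §E The DIMENSION statement of LEMMA 3.2.1 («… intersects … along an `n`-dimensional subspace»), with the real
structure modelled as a conjugate-additive bijection `σ` of `V` (v2 p. 24 L76–86: «`I∘f` is defined over `ℝ`. Hence, its
eigenspaces `L₁` and `L₂` … are defined over `ℝ` … `σ(L₁ ∩ W_{1,ℂ}) = L₁ ∩ W_{2,ℂ}` … The equality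
`dim(L₁ ∩ W_{1,ℂ}) + dim(L₁ ∩ W_{2,ℂ}) = dim(L₁) = 2n` implies that `dim(L₁ ∩ W_{1,ℂ}) = dim(L₁ ∩ W_{2,ℂ}) = n` and
similarly for `L₂`»).  MODEL of «defined over `ℝ`» ∕ `σ`: `F` carries an involution `star` (complex conjugation),
`σ : V ≃+ V` is additive with `σ(c·x) = c̄·σ(x)` (`hσ`), and `I`, `f` commute with `σ` («defined over `ℝ`»,
hypotheses `hσI`, `hσf`); `ī = −i` and `s̄ = −s` (`√−1`, `√−d` are imaginary: `hi'`, `hs'`). «`ν(I) = 2n`» is the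
hypothesis `finrank L₂ = 2n` (`L₂` = the `√d`-eigenspace), `dim V = 4n` is `hV`. -/

section RealStructure

variable [StarRing F] (σ : V ≃+ V)

/-- `σ` maps the `μ`-eigenspace of a real operator `g` (`σg = gσ`) into the `μ̄`-eigenspace.
[cite: Markman2025SecantWeil, Lemma 3.2.1 (proof), v2 p. 24 L76–84] -/
theorem conj_mem_eigenspace (hσ : ∀ (c : F) (x : V), σ (c • x) = star c • σ x) (g : Module.End F V)
    (hσg : ∀ x, σ (g x) = g (σ x)) {μ : F} {x : V} (hx : x ∈ eigenspace g μ) : σ x ∈ eigenspace g (star μ) := by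
  rw [mem_eigenspace_iff] at hx ⊢
  rw [← hσg, hx, hσ]

/-- «`σ(L₁ ∩ W_{1,ℂ}) = L₁ ∩ W_{2,ℂ}`» at the level of dimensions: `σ` restricts to an injective conjugate-additive map
from the `(μ, ν)`-joint eigenspace to the `(μ̄, ν̄)`-joint eigenspace, so `dim E(μ, ν) ≤ dim E(μ̄, ν̄)` (and, applied
twice, equality). [cite: Markman2025SecantWeil, Lemma 3.2.1 (proof), v2 p. 24 L84–86] -/
theorem finrank_joint_le_conj [FiniteDimensional F V] (hσ : ∀ (c : F) (x : V), σ (c • x) = star c • σ x)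
    (hσI : ∀ x, σ (I x) = I (σ x)) (hσf : ∀ x, σ (f x) = f (σ x)) (μ ν : F) :
    finrank F ↥(eigenspace I μ ⊓ eigenspace f ν) ≤ finrank F ↥(eigenspace I (star μ) ⊓ eigenspace f (star ν)) := by
  -- the restricted map
  let j : ↥(eigenspace I μ ⊓ eigenspace f ν) →+ ↥(eigenspace I (star μ) ⊓ eigenspace f (star ν)) :=
    { toFun := fun x => ⟨σ x, ⟨conj_mem_eigenspace σ hσ I hσI x.2.1, conj_mem_eigenspace σ hσ f hσf x.2.2⟩⟩
      map_zero' := by ext; simp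
      map_add' := by intro x y; ext; simp }
  have hj : Function.Injective j := by
    intro x y hxy
    have : σ x = σ y := congrArg Subtype.val hxy
    exact Subtype.ext (σ.injective this)
  have hrank := rank_le_of_injective_injectiveₛ (R := F) (R' := F) (star : F → F) j star_injective hj
    (fun r m => by ext; simp [j, hσ, star_star])
  exact Module.finrank_le_finrank_of_rank_le_rank (by simpa using hrank) (Module.rank_lt_aleph0 F _)

/-- Equal dimensions of conjugate joint eigenspaces: `dim E(μ, ν) = dim E(μ̄, ν̄)`.
[cite: Markman2025SecantWeil, Lemma 3.2.1 (proof), v2 p. 24 L84–86] -/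
theorem finrank_joint_eq_conj [FiniteDimensional F V] (hσ : ∀ (c : F) (x : V), σ (c • x) = star c • σ x)
    (hσI : ∀ x, σ (I x) = I (σ x)) (hσf : ∀ x, σ (f x) = f (σ x)) (μ ν : F) :
    finrank F ↥(eigenspace I μ ⊓ eigenspace f ν) = finrank F ↥(eigenspace I (star μ) ⊓ eigenspace f (star ν)) := by
  apply le_antisymm (finrank_joint_le_conj f I σ hσ hσI hσf μ ν)
  have h := finrank_joint_le_conj f I σ hσ hσI hσf (star μ) (star ν)
  rwa [star_star, star_star] at h

/-- LEMMA 3.2.1, first statement: «Assume that `ν(I) = 2n`. … Then each of `V^{1,0}` and `V^{0,1}` intersects each of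
`W_{1,ℂ}` and `W_{2,ℂ}` along an `n`-dimensional subspace» — in the model of this section (`dim V = 4n`;
`ν(I) = dim L₂ = 2n`; `I`, `f` real, commuting, `I² = −𝟙`, `f² = −d𝟙`; `ī = −i`, `s̄ = −s`; `2 ≠ 0`, `i ≠ 0`, `s ≠ 0`).
Proof as printed: `L₁ ⊕ L₂ = V` gives `dim L₁ = 2n`; `L₁ = E(i,s) ⊕ E(−i,−s)` with `σ`-conjugate (equal-dimensional)
summands gives `n + n`; likewise for `L₂ = E(i,−s) ⊕ E(−i,s)`. [cite: Markman2025SecantWeil, Lemma 3.2.1, v2 p. 24 L49–51, L76–86] -/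
theorem lemma321_finrank [FiniteDimensional F V] (hσ : ∀ (c : F) (x : V), σ (c • x) = star c • σ x)
    (hσI : ∀ x, σ (I x) = I (σ x)) (hσf : ∀ x, σ (f x) = f (σ x)) (hi' : star i = -i) (hs' : star s = -s)
    (hc : ∀ x, f (I x) = I (f x)) (hI2 : ∀ x, I (I x) = -x) (hf2 : ∀ x, f (f x) = -(d • x))
    (hi : i * i = -1) (hs : s * s = -d) (h2 : (2 : F) ≠ 0) (hs0 : s ≠ 0) (hi0 : i ≠ 0) (n : ℕ)
    (hV : finrank F V = 4 * n) (hν : finrank F ↥(eigenspace (I * f) (-(i * s))) = 2 * n) :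
    finrank F ↥(eigenspace I i ⊓ eigenspace f s) = n ∧ finrank F ↥(eigenspace I (-i) ⊓ eigenspace f (-s)) = n ∧
      finrank F ↥(eigenspace I i ⊓ eigenspace f (-s)) = n ∧ finrank F ↥(eigenspace I (-i) ⊓ eigenspace f s) = n := by
  have h2is : (2 : F) * (i * s) ≠ 0 := mul_ne_zero h2 (mul_ne_zero hi0 hs0)
  have hisne : i * s ≠ -(i * s) := by
    intro h; apply h2is; linear_combination h
  have hii : i ≠ -i := by
    intro h; apply hi0
    have : (2 : F) * i = 0 := by linear_combination h
    exact (mul_eq_zero.mp this).resolve_left h2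
  have hss : s ≠ -s := by
    intro h; apply hs0
    have : (2 : F) * s = 0 := by linear_combination h
    exact (mul_eq_zero.mp this).resolve_left h2
  -- L₁ ⊔ L₂ = ⊤ and L₁ ⊓ L₂ = ⊥
  have hsup : eigenspace (I * f) (i * s) ⊔ eigenspace (I * f) (-(i * s)) = ⊤ := by
    rw [eq_top_iff]
    intro x _
    obtain ⟨a, b, c, e, ha, hb, hc', he, rfl⟩ := exists_joint_decomposition f I i s d hc hI2 hf2 hi hs h2 hs0 x
    refine Submodule.add_mem _ (Submodule.add_mem _ (Submodule.add_mem _ ?_ ?_) ?_) ?_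
    · exact Submodule.mem_sup_left (joint_le_L1 f I i s ha)
    · exact Submodule.mem_sup_right (joint_le_L2 f I i s hb)
    · exact Submodule.mem_sup_right (joint_le_L2' f I i s hc')
    · exact Submodule.mem_sup_left (joint_le_L1' f I i s he)
  have hinf : eigenspace (I * f) (i * s) ⊓ eigenspace (I * f) (-(i * s)) = ⊥ := by
    rw [eq_bot_iff]; intro x hx; rw [Submodule.mem_bot]
    exact eq_zero_of_mem_eigenspace_pair (I * f) hisne hx.1 hx.2
  have hL1 : finrank F ↥(eigenspace (I * f) (i * s)) = 2 * n := by
    have h := Submodule.finrank_sup_add_finrank_inf_eq (eigenspace (I * f) (i * s)) (eigenspace (I * f) (-(i * s)))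
    rw [hsup, hinf, finrank_top, finrank_bot, hV, hν] at h
    omega
  -- L₁ = E(i,s) ⊕ E(-i,-s), L₂ = E(i,-s) ⊕ E(-i,s)
  have hd1 : (eigenspace I i ⊓ eigenspace f s) ⊓ (eigenspace I (-i) ⊓ eigenspace f (-s)) = ⊥ := by
    rw [eq_bot_iff]; intro x hx; rw [Submodule.mem_bot]
    exact eq_zero_of_mem_eigenspace_pair I hii hx.1.1 hx.2.1
  have hd2 : (eigenspace I i ⊓ eigenspace f (-s)) ⊓ (eigenspace I (-i) ⊓ eigenspace f s) = ⊥ := by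
    rw [eq_bot_iff]; intro x hx; rw [Submodule.mem_bot]
    exact eq_zero_of_mem_eigenspace_pair I hii hx.1.1 hx.2.1
  have hsum1 := Submodule.finrank_sup_add_finrank_inf_eq (eigenspace I i ⊓ eigenspace f s)
    (eigenspace I (-i) ⊓ eigenspace f (-s))
  rw [← L1_eq f I i s d hc hI2 hf2 hi hs h2 hs0 hi0, hd1, finrank_bot, hL1] at hsum1
  have hsum2 := Submodule.finrank_sup_add_finrank_inf_eq (eigenspace I i ⊓ eigenspace f (-s))
    (eigenspace I (-i) ⊓ eigenspace f s)
  rw [← L2_eq f I i s d hc hI2 hf2 hi hs h2 hs0 hi0, hd2, finrank_bot, hν] at hsum2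
  -- σ-symmetry of the dimensions
  have hσ1 := finrank_joint_eq_conj f I σ hσ hσI hσf i s
  rw [hi', hs'] at hσ1
  have hσ2 := finrank_joint_eq_conj f I σ hσ hσI hσf i (-s)
  rw [hi', star_neg, hs', neg_neg] at hσ2
  omega

end RealStructure

/-! ### §F COROLLARY 4.0.4, proof, first sentence (v2 p. 27 L26–27): «A class `α` in `∧²(V_ℚ)` is of type (1, 1) with
respect to a complex structure `I`, if and only if `I(α) = α`.» (read BY EYE on `r_mar25v2_p27_cor404.png` `19a8525ab83314b3`;
COROLLARY 4.0.4 itself — «The classes in `(∧^*(V_ℚ))^{Spin(V)_P}` remain of Hodge type for every complex structure in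
`Ω_P`» — and the rest of its proof (Lemma 2.2.7, Lemma 4.0.3 (1)) are BY VALUE.)  MODEL: a 2-class is taken as a
bilinear form `α` on `V` (via the pairing `V ≅ V^*`); «`I(α) = α`» is `α(I x, I y) = α(x, y)`; «type (1, 1)» is
«`α` vanishes on `V^{1,0} × V^{1,0}` and on `V^{0,1} × V^{0,1}`» (no `(2,0)`/`(0,2)` part).  Cross-reference:
`EtaSimilarityWeilPolarization.lean` (`EtaSimilarity.type11_swap`, Proposition 2.4.4's proof) READS «`Θ` is of type
(1, 1)» as `Θ(Iu ∧ Iv) = Θ(u ∧ v)`; the two theorems below are the equivalence of that reading with the eigenspace one. -/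

section TypeOneOne

variable (α : LinearMap.BilinForm F V)

/-- «if `I(α) = α`» then `α` is of type (1, 1): an `I`-invariant bilinear form vanishes on `E_μ(I) × E_μ(I)` whenever
`μ² = −1` (so on `V^{1,0} × V^{1,0}` and on `V^{0,1} × V^{0,1}`), for `2 ≠ 0`.
[cite: Markman2025SecantWeil, Corollary 4.0.4 (proof), v2 p. 27 L26–27] -/
theorem typeOneOne_of_invariant (hinv : ∀ x y, α (I x) (I y) = α x y) (h2 : (2 : F) ≠ 0) {μ : F} (hμ : μ * μ = -1)
    {x y : V} (hx : x ∈ eigenspace I μ) (hy : y ∈ eigenspace I μ) : α x y = 0 := by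
  rw [mem_eigenspace_iff] at hx hy
  have h := hinv x y
  simp only [hx, hy, map_smul, LinearMap.smul_apply, smul_eq_mul, ← mul_assoc, hμ] at h
  have h' : (2 : F) * α x y = 0 := by linear_combination -h
  exact (mul_eq_zero.mp h').resolve_left h2

/-- «only if»: a bilinear form vanishing on `V^{1,0} × V^{1,0}` and on `V^{0,1} × V^{0,1}` is `I`-invariant (decompose
`x = x₊ + x₋`, `y = y₊ + y₋` into `I`-eigencomponents; the surviving cross terms pick up `i·(−i) = 1`), for `I² = −𝟙`,
`i² = −1`, `2 ≠ 0`. [cite: Markman2025SecantWeil, Corollary 4.0.4 (proof), v2 p. 27 L26–27] -/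
theorem invariant_of_typeOneOne (hI2 : ∀ x, I (I x) = -x) (hi : i * i = -1) (h2 : (2 : F) ≠ 0)
    (h10 : ∀ x y, x ∈ eigenspace I i → y ∈ eigenspace I i → α x y = 0)
    (h01 : ∀ x y, x ∈ eigenspace I (-i) → y ∈ eigenspace I (-i) → α x y = 0) (x y : V) :
    α (I x) (I y) = α x y := by
  -- eigen-components: 2x = (x - i I x) + (x + i I x)
  have hxp := proj_mem_eigenspace_I_pos I i hI2 hi x
  have hxm := proj_mem_eigenspace_I_neg I i hI2 hi x
  have hyp := proj_mem_eigenspace_I_pos I i hI2 hi y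
  have hym := proj_mem_eigenspace_I_neg I i hI2 hi y
  have a1 : α (x - i • I x) (y - i • I y) = 0 := h10 _ _ hxp hyp
  have a2 : α (x + i • I x) (y + i • I y) = 0 := h01 _ _ hxm hym
  -- `I` maps each of its eigenspaces into itself
  have self_map : ∀ (μ : F) (z : V), z ∈ eigenspace I μ → I z ∈ eigenspace I μ := by
    intro μ z hz
    rw [mem_eigenspace_iff] at hz ⊢
    rw [hz, map_smul, hz]
  have b1 : α (I (x - i • I x)) (I (y - i • I y)) = 0 := h10 _ _ (self_map i _ hxp) (self_map i _ hyp)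
  have b2 : α (I (x + i • I x)) (I (y + i • I y)) = 0 := h01 _ _ (self_map (-i) _ hxm) (self_map (-i) _ hym)
  -- expand everything bilinearly
  simp only [map_sub, map_add, map_smul, LinearMap.sub_apply, LinearMap.add_apply, LinearMap.smul_apply, smul_eq_mul,
    hI2, map_neg, LinearMap.neg_apply] at a1 a2 b1 b2
  have key : (2 : F) * 2 * (α (I x) (I y) - α x y) = 0 := by
    linear_combination b1 + b2 - a1 - a2 + (2 * (α (I x) (I y) - α x y)) * hi
  have h4 : (2 : F) * 2 ≠ 0 := mul_ne_zero h2 h2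
  have := (mul_eq_zero.mp key).resolve_left h4
  exact (sub_eq_zero.mp this)

end TypeOneOne

end JointEigenspaces321

end Literature.AlgebraicGeometry.Markman2025
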